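import Summits.Ventures.PercRepro.S1CoreCapRank
import Summits.Ventures.PercRepro.S1CoreCapThree
import Summits.Ventures.PercRepro.S1CoreCapFive

/-!
# PercRepro — THE 4-CIRCUIT-CAP BRIDGE: `#4circ(e) ≤ Q` from `FourCapSpec capPaper ν Q` (p1, gen 22; the s₄ seat)

`proofs/P1-S4-CAPBRIDGE.md` §5. On the e-free core of nullity `ν`, the lines of the 4-circuits through `e`
(`S1CoreCapClasses.config`) form an abstract configuration of weighted classes that satisfies every clause of the
search's spec `S1CoreCapSpec.FourCapSpec`: weights `1 / 2` (lines of the core have `≤ 3` points), `≥ 3` classes of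
total weight `≤ 5` per line (planes `≤ 6`), two distinct lines share `≤ 1` class (two planes through `e` sharing two
independent directions coincide), the cost clause and the plane clauses (`S1CoreCapRank`). Every 4-circuit through
`e` lies in the plane of its line, and a plane with `k` classes, `f` of them fat, carries at most `capPaper k f`
four-circuits through `e` (`S1CoreCapFat`, `S1CoreCapFive`, `S1CoreCapThree`). Summing over the lines:
`#4circ(e) ≤ Σ_L capPaper ≤ Q` whenever `FourCapSpec capPaper ν Q` — the spec the two searches verify with
`Q = Q*(ν) = 1, 4, 5, 8, 11, 16, 19` (`ν ≤ 7`).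
Axioms: standard.
-/

open scoped Matroid

namespace PercRepro

namespace S1

open Set

open FourCap

variable {α : Type}

/-- Closures of nested sets of equal (finite) rank coincide: `X ⊆ cl C`, `r (cl C) ≤ r X` ⟹ `cl X = cl C`. -/
theorem closure_eq_closure_of_subset_closure_of_eRk_le (M : Matroid α) {X C : Set α} (hX : X ⊆ M.closure C)
    (hle : M.eRk (M.closure C) ≤ M.eRk X) (hfin : M.eRk X ≠ ⊤) : M.closure X = M.closure C := by
  refine le_antisymm (M.closure_subset_closure_of_subset_closure hX) ?_
  intro y hy
  by_contra hyX
  have hyE : y ∈ M.E := M.closure_subset_ground _ hy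
  have h1 : M.eRk (insert y X) = M.eRk X + 1 := M.eRk_insert_eq_add_one ⟨hyE, hyX⟩
  have h2 : M.eRk (insert y X) ≤ M.eRk X := by
    refine (M.eRk_mono (insert_subset hy hX)).trans hle
  rw [h1] at h2
  exact lt_irrefl _ ((ENat.add_one_le_iff hfin).1 h2)

open Classical in
/-- **Two distinct lines of the configuration share at most one class.** -/
theorem card_inter_le_one_of_config (M : Matroid α) [M.Finite]
    (hfree : ∀ e ∈ M.E, ∃ A ⊆ M.E \ {e}, e ∉ M.closure A ∧ e ∉ M.closure ((M.E \ {e}) \ A))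
    {e : α} (he : e ∈ M.E) {L L' : Finset (Set α)} (hL : L ∈ config M e) (hL' : L' ∈ config M e) (hne : L ≠ L') :
    (L ∩ L').card ≤ 1 := by
  by_contra hlt
  push Not at hlt
  obtain ⟨v₁, hv₁, v₂, hv₂, hv12⟩ := Finset.one_lt_card.1 hlt
  obtain ⟨C, ⟨hC, h4, heC⟩, rfl⟩ := mem_config.1 hL
  obtain ⟨C', ⟨hC', h4', heC'⟩, rfl⟩ := mem_config.1 hL'
  obtain ⟨q₁, hq₁E, hq₁e, rfl⟩ := exists_rep_of_mem_lineOf (Finset.mem_inter.1 hv₁).1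
  obtain ⟨q₂, hq₂E, hq₂e, rfl⟩ := exists_rep_of_mem_lineOf (Finset.mem_inter.1 hv₂).1
  have hpts := pts_lineOf M hC.subset_ground heC
  have hpts' := pts_lineOf M hC'.subset_ground heC'
  have hmem : ∀ q, q ∈ M.E → q ≠ e → ∀ {D : Set α} (hD : M.IsCircuit D) (heD : e ∈ D),
      cls M e q ∈ lineOf M e D → q ∈ M.closure D := by
    intro q hqE hqe D hD heD hq
    have : q ∈ pts (lineOf M e D) := mem_pts.2 ⟨cls M e q, hq, mem_cls_self M hqE hqe.symm⟩
    rw [pts_lineOf M hD.subset_ground heD] at this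
    exact this.1
  have hT : ({e, q₁, q₂} : Set α) ⊆ M.closure C ∩ M.closure C' := by
    intro t ht; simp only [mem_insert_iff, mem_singleton_iff] at ht
    rcases ht with rfl | rfl | rfl
    · exact ⟨M.mem_closure_of_mem' heC (hC.subset_ground heC), M.mem_closure_of_mem' heC' (hC'.subset_ground heC')⟩
    · exact ⟨hmem t hq₁E hq₁e hC heC (Finset.mem_inter.1 hv₁).1, hmem t hq₁E hq₁e hC' heC' (Finset.mem_inter.1 hv₁).2⟩
    · exact ⟨hmem t hq₂E hq₂e hC heC (Finset.mem_inter.1 hv₂).1, hmem t hq₂E hq₂e hC' heC' (Finset.mem_inter.1 hv₂).2⟩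
  have hr3 : 3 ≤ M.eRk (M.closure C ∩ M.closure C') := by
    rw [← eRk_triple_eq_three_of_cls_ne M hfree he hq₁E hq₂E hq₁e.symm hq₂e.symm hv12]
    exact M.eRk_mono hT
  have hfin : M.eRk (M.closure C ∩ M.closure C') ≠ ⊤ :=
    ne_top_of_le_ne_top (by simp : (3 : ℕ∞) ≠ ⊤)
      ((M.eRk_mono inter_subset_left).trans (eRk_closure_fourCircuit M hC h4).le)
  have h1 := closure_eq_closure_of_subset_closure_of_eRk_le M inter_subset_left
    ((eRk_closure_fourCircuit M hC h4).le.trans hr3) hfin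
  have h2 := closure_eq_closure_of_subset_closure_of_eRk_le M inter_subset_right
    ((eRk_closure_fourCircuit M hC' h4').le.trans hr3) hfin
  apply hne
  unfold lineOf
  rw [h1.symm.trans h2]

/-- **The per-line cap**: the 4-circuits through `e` inside the plane of a 4-circuit `C₀ ∋ e` number at most
`capPaper k f`, where `k` is the number of classes of its line and `f` the number of fat ones. -/
theorem ncard_fourCircuitsThrough_in_closure_le_capPaper (M : Matroid α) [M.Finite]
    (hfree : ∀ e ∈ M.E, ∃ A ⊆ M.E \ {e}, e ∉ M.closure A ∧ e ∉ M.closure ((M.E \ {e}) \ A))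
    {e : α} (he : e ∈ M.E) {C₀ : Set α} (hC₀ : M.IsCircuit C₀) (h4 : C₀.ncard = 4) (heC₀ : e ∈ C₀) :
    {C : Set α | M.IsCircuit C ∧ C.ncard = 4 ∧ e ∈ C ∧ C ⊆ M.closure C₀}.ncard ≤
      capPaper (lineOf M e C₀).card (fat Set.ncard (lineOf M e C₀)) := by
  classical
  set P := M.closure C₀ with hPdef
  set L := lineOf M e C₀ with hLdef
  have hPE : P ⊆ M.E := M.closure_subset_ground C₀
  have hPfin : P.Finite := M.ground_finite.subset hPE
  have heP : e ∈ P := M.mem_closure_of_mem' heC₀ (hC₀.subset_ground heC₀)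
  have hrP : M.eRk P ≤ 3 := (eRk_closure_fourCircuit M hC₀ h4).le
  have hP6 : P.ncard ≤ 6 := ThmN.ncard_le_six_of_eRk_le_three_of_free M hfree hPE hrP
  have hpts : pts L = P \ {e} := pts_lineOf M hC₀.subset_ground heC₀
  have hcls : ∀ v ∈ L, ∃ q ∈ M.E, q ≠ e ∧ v = cls M e q := fun v hv => exists_rep_of_mem_lineOf hv
  have hw : ∀ v ∈ L, v.ncard = 1 ∨ v.ncard = 2 := by
    intro v hv
    obtain ⟨q, hqE, hqe, rfl⟩ := hcls v hv
    have h1 := ncard_cls_le_two M hfree he q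
    have h2 : 0 < (cls M e q).ncard := ncard_pos (cls_finite M e q) |>.2 ⟨q, mem_cls_self M hqE hqe.symm⟩
    omega
  have hk3 : 3 ≤ L.card := three_le_card_lineOf M hC₀ h4 heC₀
  have hPc : P.ncard = L.card + fat Set.ncard L + 1 := by
    have h1 := ncard_sdiff_singleton_add_one heP hPfin
    rw [← hpts, ncard_pts_eq_sum M hfree he L hcls] at h1
    have h2 := wsum_eq_card_add_fat Set.ncard L hw
    unfold wsum at h2
    omega
  -- the fat classes give M-lines through `e`
  have hfat : ∀ v ∈ L, v.ncard = 2 → ∃ p q, p ≠ q ∧ p ∈ P ∧ q ∈ P ∧ p ≠ e ∧ q ≠ e ∧ v = {p, q} ∧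
      M.eRk {e, p, q} ≤ 2 := by
    intro v hv h2
    obtain ⟨q₀, hq₀E, hq₀e, rfl⟩ := hcls v hv
    obtain ⟨p, q, hpq, hv⟩ := ncard_eq_two.1 h2
    have hp : p ∈ cls M e q₀ := hv ▸ (by simp)
    have hq : q ∈ cls M e q₀ := hv ▸ (by simp)
    have hpP : p ∈ P := by
      have : p ∈ pts L := mem_pts.2 ⟨_, hv ▸ (hv ▸ hv ▸ ‹cls M e q₀ ∈ L›), hp⟩
      rw [hpts] at this; exact this.1
    have hqP : q ∈ P := by
      have : q ∈ pts L := mem_pts.2 ⟨_, ‹cls M e q₀ ∈ L›, hq⟩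
      rw [hpts] at this; exact this.1
    refine ⟨p, q, hpq, hpP, hqP, ne_of_mem_cls M hp, ne_of_mem_cls M hq, hv, ?_⟩
    have hq' : q ∈ cls M e p := by
      rw [cls_eq_of_mem M hfree he hq₀E hq₀e.symm hp]; exact hq
    exact eRk_triple_le_two_of_mem_cls M he (mem_ground_of_mem_cls M hp) hq'
  -- case analysis on the shape `(k, f)`
  have hkf : (L.card = 3 ∧ fat Set.ncard L = 0) ∨ (L.card = 4 ∧ fat Set.ncard L = 0) ∨
      (L.card = 5 ∧ fat Set.ncard L = 0) ∨ (L.card = 3 ∧ fat Set.ncard L = 1) ∨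
      (L.card = 4 ∧ fat Set.ncard L = 1) ∨ (L.card = 3 ∧ fat Set.ncard L = 2) := by omega
  obtain ⟨capPaper_3_0, capPaper_4_0, capPaper_5_0, capPaper_3_1, capPaper_4_1, capPaper_3_2⟩ := capPaper_values
  rcases hkf with ⟨hk, hf⟩ | ⟨hk, hf⟩ | ⟨hk, hf⟩ | ⟨hk, hf⟩ | ⟨hk, hf⟩ | ⟨hk, hf⟩ <;> rw [hk, hf]
  · -- (3, 0): a 4-point plane carries one 4-subset
    rw [capPaper_3_0]
    have hP4 : P.ncard = 4 := by omega
    have hsub : {C : Set α | M.IsCircuit C ∧ C.ncard = 4 ∧ e ∈ C ∧ C ⊆ P} ⊆ {P} := by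
      rintro C ⟨_, hC4, _, hCP⟩
      exact mem_singleton_iff.2 (eq_of_subset_of_ncard_le hCP (by omega) hPfin)
    exact (ncard_le_ncard hsub (finite_singleton P)).trans (by rw [ncard_singleton])
  · -- (4, 0): the binomial bound `C(4, 3)`
    rw [capPaper_4_0]
    have hQ4 : (P \ {e}).ncard = 4 := by
      have := ncard_sdiff_singleton_add_one heP hPfin; omega
    have := ncard_fourCircuitsThrough_in_plane_le_of_kill M hPE (e := e) (K := ∅) (empty_subset _)
      (fun _ _ _ _ _ h => h)
    rw [hQ4, ncard_empty] at this
    exact this.trans (by decide)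
  · -- (5, 0): cap(5) = 5
    rw [capPaper_5_0]
    exact ncard_fourCircuitsThrough_in_six_plane_le_five M hfree hPE hrP (by omega) heP
  · -- (3, 1): the fat entry 2
    rw [capPaper_3_1]
    have hf1 : (L.filter (fun v => v.ncard = 2)).card = 1 := hf
    obtain ⟨v, hv⟩ := Finset.card_eq_one.1 hf1
    have hvL : v ∈ L.filter (fun v => v.ncard = 2) := hv ▸ Finset.mem_singleton_self v
    rw [Finset.mem_filter] at hvL
    obtain ⟨p, q, hpq, hpP, hqP, hpe, hqe, _, hr⟩ := hfat v hvL.1 hvL.2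
    exact ncard_fourCircuitsThrough_in_five_plane_fat_le_two M hPE (by omega) heP hpP hqP hpe hqe hpq hr
  · -- (4, 1): cap(5) = 5 again
    rw [capPaper_4_1]
    exact ncard_fourCircuitsThrough_in_six_plane_le_five M hfree hPE hrP (by omega) heP
  · -- (3, 2): the two fat classes
    rw [capPaper_3_2]
    have hf2 : (L.filter (fun v => v.ncard = 2)).card = 2 := hf
    obtain ⟨v₁, v₂, hv12, hv⟩ := Finset.card_eq_two.1 hf2
    have hv₁ : v₁ ∈ L.filter (fun v => v.ncard = 2) := hv ▸ (by simp)
    have hv₂ : v₂ ∈ L.filter (fun v => v.ncard = 2) := hv ▸ (by simp)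
    rw [Finset.mem_filter] at hv₁ hv₂
    obtain ⟨p, q, hpq, hpP, hqP, hpe, hqe, hv₁eq, hr1⟩ := hfat v₁ hv₁.1 hv₁.2
    obtain ⟨r, s, hrs, hrP', hsP, hre, hse, hv₂eq, hr2⟩ := hfat v₂ hv₂.1 hv₂.2
    -- distinct classes are disjoint
    obtain ⟨q₁, hq₁E, hq₁e, hc₁⟩ := hcls v₁ hv₁.1
    obtain ⟨q₂, hq₂E, hq₂e, hc₂⟩ := hcls v₂ hv₂.1
    have hdisj : Disjoint v₁ v₂ := by
      rw [hc₁, hc₂]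
      exact cls_disjoint_of_ne M hfree he hq₁E hq₂E hq₁e.symm hq₂e.symm (hc₁ ▸ hc₂ ▸ hv12)
    have hpv : p ∈ v₁ := hv₁eq ▸ (by simp)
    have hqv : q ∈ v₁ := hv₁eq ▸ (by simp)
    have hrv : r ∈ v₂ := hv₂eq ▸ (by simp)
    have hsv : s ∈ v₂ := hv₂eq ▸ (by simp)
    have hpr : p ≠ r := fun h => Set.disjoint_left.1 hdisj hpv (h ▸ hrv)
    have hps : p ≠ s := fun h => Set.disjoint_left.1 hdisj hpv (h ▸ hsv)
    have hqr : q ≠ r := fun h => Set.disjoint_left.1 hdisj hqv (h ▸ hrv)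
    have hqs : q ≠ s := fun h => Set.disjoint_left.1 hdisj hqv (h ▸ hsv)
    exact ncard_fourCircuitsThrough_in_six_plane_two_fat_le_three M hfree hPE hrP (by omega) heP hpP hqP hrP'
      hsP hpe hqe hre hse hpq hrs hpr hps hqr hqs hr1 hr2

open Classical in
/-- **THE BRIDGE**: on the e-free core of nullity `d`, the 4-circuits through a point `e` number at most `Q`
whenever the 4-circuit-cap search's spec `FourCapSpec capPaper d Q` holds (i.e. `Q ≥ Q*(d)`): the lines of the
4-circuits through `e` form a configuration of weighted classes satisfying every clause of the spec, and each line
carries at most its cap. -/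
theorem ncard_fourCircuitsThrough_le_of_fourCapSpec (M : Matroid α) [M.Finite]
    (hfree : ∀ e ∈ M.E, ∃ A ⊆ M.E \ {e}, e ∉ M.closure A ∧ e ∉ M.closure ((M.E \ {e}) \ A))
    {d : ℕ} (hd : M.E.encard = M.eRank + d) {e : α} (he : e ∈ M.E) {Q : ℕ}
    (hspec : FourCapSpec capPaper d Q) :
    {C : Set α | M.IsCircuit C ∧ C.ncard = 4 ∧ e ∈ C}.ncard ≤ Q := by
  -- the six clauses
  have h1 : ∀ L ∈ config M e, ∀ v ∈ L, Set.ncard v = 1 ∨ Set.ncard v = 2 := by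
    intro L hL v hv
    obtain ⟨q, hqE, hqe, rfl⟩ := exists_rep_of_mem_config hL hv
    have := ncard_cls_le_two M hfree he q
    have h2 : 0 < (cls M e q).ncard := ncard_pos (cls_finite M e q) |>.2 ⟨q, mem_cls_self M hqE hqe.symm⟩
    omega
  have h2 : ∀ L ∈ config M e, 3 ≤ L.card ∧ wsum Set.ncard L ≤ 5 := by
    intro L hL
    obtain ⟨C, ⟨hC, h4, heC⟩, rfl⟩ := mem_config.1 hL
    refine ⟨three_le_card_lineOf M hC h4 heC, ?_⟩
    have hcls : ∀ v ∈ lineOf M e C, ∃ q ∈ M.E, q ≠ e ∧ v = cls M e q := fun v hv => exists_rep_of_mem_lineOf hv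
    have hsum := ncard_pts_eq_sum M hfree he _ hcls
    rw [pts_lineOf M hC.subset_ground heC] at hsum
    have hPfin : (M.closure C).Finite := M.ground_finite.subset (M.closure_subset_ground C)
    have h6 := ThmN.ncard_le_six_of_eRk_le_three_of_free M hfree (M.closure_subset_ground C)
      (eRk_closure_fourCircuit M hC h4).le
    have := ncard_sdiff_singleton_add_one (M.mem_closure_of_mem' heC (hC.subset_ground heC)) hPfin
    unfold wsum
    omega
  have h3 : ∀ L ∈ config M e, ∀ L' ∈ config M e, L ≠ L' → (L ∩ L').card ≤ 1 :=
    fun L hL L' hL' hne => card_inter_le_one_of_config M hfree he hL hL' hne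
  have h4 : ∀ l : List (Finset (Set α)), l.Nodup → (∀ L ∈ l, L ∈ config M e) →
      wsum Set.ncard (unionL l) ≤ d + lineRank l := fun l _ hl => wsum_unionL_le M hfree hd he l hl
  have h5 : ∀ l : List (Finset (Set α)), l.Nodup → (∀ L ∈ l, L ∈ config M e) → lineRank l ≤ 3 →
      (unionL l).card ≤ 9 := fun l _ hl => (card_unionL_le_of_lineRank_le M hfree he l hl).1
  have h6 : ∀ l : List (Finset (Set α)), l.Nodup → (∀ L ∈ l, L ∈ config M e) → lineRank l ≤ 4 →
      (unionL l).card ≤ 20 := fun l _ hl => (card_unionL_le_of_lineRank_le M hfree he l hl).2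
  have hsum := hspec (Set α) Set.ncard (config M e) h1 h2 h3 h4 h5 h6
  -- the fibre count
  have hfin := fourCircuitsThrough_finite M e
  rw [show {C : Set α | M.IsCircuit C ∧ C.ncard = 4 ∧ e ∈ C} = fourCircuitsThrough M e from rfl,
    ncard_eq_toFinset_card _ hfin, Finset.card_eq_sum_card_image (lineOf M e)]
  refine le_trans (Finset.sum_le_sum (fun L hL => ?_)) hsum
  obtain ⟨C₀, ⟨hC₀, h4₀, heC₀⟩, rfl⟩ := mem_config.1 hL
  refine le_trans ?_ (ncard_fourCircuitsThrough_in_closure_le_capPaper M hfree he hC₀ h4₀ heC₀)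
  rw [← ncard_coe_finset]
  refine ncard_le_ncard ?_ ((M.ground_finite.finite_subsets).subset (fun C hC => hC.1.subset_ground))
  intro C hC
  rw [Finset.mem_coe, Finset.mem_filter, Set.Finite.mem_toFinset] at hC
  obtain ⟨⟨hCc, hC4, heC⟩, hline⟩ := hC
  refine ⟨hCc, hC4, heC, ?_⟩
  rw [← closure_eq_of_lineOf_eq M hCc.subset_ground hC₀.subset_ground heC heC₀ hline]
  exact M.subset_closure C hCc.subset_ground


end S1

end PercRepro
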